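/-
Copyright: statement-level skeleton of a published paper (lit-balaban cell, Phase-2 proof seat p19, gen 3). No claims beyond
what the kernel checks below.
-/
import Mathlib
import Literature.MathematicalPhysics.QuantumFieldTheory.Balaban1983to89.B3Ineq213Proof

/-!
# B3 — T. Bałaban, *(Higgs)₂,₃ quantum fields in a finite volume. III. Renormalization*, CMP **88** (1983) 411–445
[Balaban1983Higgs3] — Sect. 2, pp. 424–428: **the bound (1.33) of Proposition 2.1 for the localized lattice graph amplitudes,
ASSEMBLED**: (2.6)–(2.7) (decomposition of the propagators, sum over orderings) + (2.13) + (2.15) (MODEL INSTANCE of the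
proof of Proposition 2.1, in the generality of Proposition 2.2)

statement-level skeleton of published theorems with citation tags; proofs where landed; nothing here is a claim about
the Yang–Mills mass gap

PDF held: `paper:balaban1983-higgs-2-3-quantum-fields-finite-volume` (journal page = PDF page + 410); displays read on
the ×2 renders `pub-balaban/b2b-balaban-ref1/pages/1983-cmp88-higgs23-III/1983-cmp88-higgs23-III-p014 … p018-x2.png`
(pp. 424–428).

Companion of the Phase-2 proof of SKELETON row **B3.Eq2.13-2.14** (unit `lit-balaban-p19` gen 3; files `B3Ineq213Points` →
`B3Ineq213TreeLength` → `B3Ineq213Amplitude` → `B3Ineq213Proof`), knitting it with r15's (2.6)–(2.7) (`B3.Assignment`,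
`B3.display27`, p243389/`B3.lean`) and gen 2's (2.15) (`B3Ineq215.Model.ineq215_of_pos`); bears on rows B3.Prop2.1 /
B3.Prop2.2 (typed p238938 as `B3Prop1.Prop21`/`Prop22` over abstract carriers — NOT instantiated by name here).

WHAT IS REPRODUCED.  pp. 424–425 [PDF 14–15], verbatim: *"Our first step in the proof of the theorem is to write the expression
E(G, {□(v)}_{v∈G}, Φ_ext, A_ext) … as a sum obtained by decomposing all the propagators corresponding to the lines of G′
according to the equality G_k(Ω, B̃) = … = Σ_{j=0}^{k−1} G^η_{(j)}(Ω, B̃), (2.6) … Thus we get a sum of new expressions obtained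
by replacing in each line l of the graph G′ the corresponding propagator by a propagator G^η_{(j_l)}, 0 ≦ j_l ≦ k−1. … We can
write E(G′) as a sum Σ_j E(G′(j)). … Thus for each ordering l̃ we assign some set J(l̃) of the indices j … We get the equality
E(G′, {□(v)}_{v∈G}, Φ′_ext, A_ext) = Σ_{orderings l̃} Σ_{j∈J(l̃)} E(G′(j), {□(v)}_{v∈G}, Φ′_ext, A_ext). (2.7) To prove the
theorem it is sufficient to prove the estimate (1.33) for the sum with fixed ordering l̃ on the right side above."*, p. 426:
*"Thus it is sufficient to prove the estimate (1.33) under this assumption [G₁, …, G_m have positive degrees]"*, p. 427: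
*"To prove the theorem it is sufficient to prove that Σ_{j∈J(l̃)} Σ_{{Δ(v)}} Ẽ(G(j), {Δ(v)}_{v∈G}) ≦ O(1) (2.15)"*, and
p. 428 (Proposition 2.2): *"We can have vertices with an arbitrary number of legs and arbitrary power of η. We can have lines …
with arbitrary dimensions instead of −d+2. The only thing which matters is that propagators have representations corresponding
to (2.6) with the estimates corresponding to (2.10)–(2.12), so that we have the inequality (2.13) with the proper
generalization of (2.14)."*  KERNEL-CHECKED HERE for the localized lattice graph amplitudes `Amp` of `B3Ineq213Amplitude`
(vertex functions bounded by couplings · norms · `η^{e_v}`; line kernels `K_l(t; ·, ·)`, `t = 0, …, k−1`, obeying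
(2.10)–(2.12); connected graph) over count data `G` (`B3Ineq215.Counts`): (i) **(2.6)** — the TOTAL amplitude `Amp.Etot`, each
line carrying the full propagator `Σ_{t=0}^{k−1} K_l(t; ·, ·)`, equals `Σ_j E(G(j))` over all scale assignments (`Etot_eq_sum_E`,
multilinearity); (ii) **(2.7)** — relabeling the lines along an ordering l̃ = σ (`relabelCounts`, `Amp.relabel`) does not change
the amplitude (`E_relabel`), so that the gen-3 estimate (2.13) and gen 2's (2.15) apply ordering by ordering; (iii) **(1.33)
for the sum with fixed ordering l̃** (`bound133_ordering`): for EVERY admissible assignment l̃ ↦ J(l̃) (`B3.Assignment`) and every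
ordering σ whose subgraphs `G_i` have connected components of positive degree, `|Σ_{j∈J(l̃)} E(G(j), {□(v)}, Φ′, A)| ≤ (Π_l C_l) ·
const215(G along σ) · e^{d_v(G)} λ^{d_s(G)} exp[−½δ₁ d({□(v)})] (Π N^Φ_v)(Π N^A_v)`; (iv) **(1.33) for `E(G′)` itself**
(`bound133_total`): `|E(G′, {□(v)}, Φ′, A)| ≤ (Π_l C_l)(Σ_σ const215(G along σ)) · e^{d_v}λ^{d_s} exp[−½δ₁ d({□(v)})]
(ΠN^Φ)(ΠN^A)`, uniformly in `k` and the unit cubes, under the hypothesis that for every ordering the components of the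
subgraphs `G_1 ⊂ … ⊂ G_m` have positive degree (implied by the printed hypothesis of Proposition 2.1 after the preparatory
step (2.8)–(2.9), p. 426).  Not modelled: the integration-by-parts step (2.8)–(2.9) removing the degree-0 subgraphs (2.4)
(rows B3.Eq2.8-2.9), the dependence *"O(1) depends on n̄ only"* (here the constant is explicit in the count data), and the
abstract family statement `B3Prop1.Prop21` (r15) — this file is the model instance of its proof, not an inhabitant of it.
-/

open Finset

namespace Literature.MathematicalPhysics.QuantumFieldTheory.Balaban1983to89.B3Ineq213

open B3Ineq215 B3Sect2FirstEstimate

variable {V : Type} [Fintype V] [DecidableEq V] {m : ℕ}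

/-! ## (2.7): relabeling the lines along an ordering l̃ -/

/-- The count data of (2.14) with the lines renumbered along the ordering l̃ = σ: the new line `i` (= l(i+1)) is the old line
`σ i`; endpoints, differentiations and averaged legs are carried along, everything else is unchanged.
[cite: Balaban1983Higgs3, (2.7) p.425] -/
def relabelCounts (G : Counts V m) (σ : Equiv.Perm (Fin m)) : Counts V m where
  src := fun i => G.src (σ i)
  tgt := fun i => G.tgt (σ i)
  touches := fun v => by
    obtain ⟨l, hl⟩ := G.touches v
    exact ⟨σ.symm l, by simpa using hl⟩
  diffOn := fun v i => G.diffOn v (σ i)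
  vecLegAvg := fun v i => G.vecLegAvg v (σ i)
  etaPow := G.etaPow
  d := G.d
  L := G.L
  δ₁ := G.δ₁
  d_pos := G.d_pos
  two_le_L := G.two_le_L
  δ₁_pos := G.δ₁_pos

/-- The relabeled line dimensions are the old ones along σ. [cite: Balaban1983Higgs3, (2.14) p.427] -/
theorem lineDim_relabelCounts (G : Counts V m) (σ : Equiv.Perm (Fin m)) (i : Fin m) :
    (relabelCounts G σ).lineDim i = G.lineDim (σ i) := rfl

/-- Relabeling keeps `L`. [cite: Balaban1983Higgs3, (2.14) p.427] -/
theorem relabelCounts_toModel_L (G : Counts V m) (σ : Equiv.Perm (Fin m)) : (relabelCounts G σ).toModel.L = G.L := rfl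

/-- Relabeling keeps `δ₀ = ½δ₁`. [cite: Balaban1983Higgs3, (2.14) p.427] -/
theorem relabelCounts_toModel_δ₀ (G : Counts V m) (σ : Equiv.Perm (Fin m)) :
    (relabelCounts G σ).toModel.δ₀ = G.δ₁ / 2 := rfl

namespace Amp

variable {G : Counts V m} (A : Amp G.toModel)

/-- The amplitude with its lines renumbered along the ordering l̃ = σ (kernels and constants carried along; vertex data, `k`
and the unit cubes unchanged). [cite: Balaban1983Higgs3, (2.7) p.425] -/
noncomputable def relabel (σ : Equiv.Perm (Fin m)) : Amp (relabelCounts G σ).toModel where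
  k := A.k
  box := A.box
  u := A.u
  K := fun i => A.K (σ i)
  C := fun i => A.C (σ i)
  eRun := A.eRun
  lamRun := A.lamRun
  dv := A.dv
  ds := A.ds
  NPhi := A.NPhi
  NA := A.NA
  C_nonneg := fun i => A.C_nonneg (σ i)
  eRun_nonneg := A.eRun_nonneg
  lamRun_nonneg := A.lamRun_nonneg
  NPhi_nonneg := A.NPhi_nonneg
  NA_nonneg := A.NA_nonneg
  e_nonneg := A.e_nonneg
  conn := by
    intro u w
    refine Relation.EqvGen.mono ?_ u w (A.conn u w)
    rintro a b ⟨l, ha, hb⟩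
    refine ⟨σ.symm l, ?_, ?_⟩
    · show G.src (σ (σ.symm l)) = a
      rw [Equiv.apply_symm_apply]
      exact ha
    · show G.tgt (σ (σ.symm l)) = b
      rw [Equiv.apply_symm_apply]
      exact hb
  u_le := A.u_le
  K_le := fun i t ht x x' => A.K_le (σ i) t ht x x'

/-- The product of the kernel constants is unchanged by relabeling. [cite: Balaban1983Higgs3, (2.7) p.425] -/
theorem prod_C_relabel (σ : Equiv.Perm (Fin m)) : ∏ i, (A.relabel σ).C i = ∏ l, A.C l := by
  show ∏ i, A.C (σ i) = ∏ l, A.C l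
  exact Equiv.prod_comp σ A.C

/-- **(2.7), the relabeling step**: the amplitude at the scale assignment `j` equals the relabeled amplitude at `j ∘ σ`
(the product over the lines is merely reindexed). [cite: Balaban1983Higgs3, (2.7) p.425] -/
theorem E_relabel (σ : Equiv.Perm (Fin m)) (j : Fin m → ℕ) : (A.relabel σ).E (j ∘ σ) = A.E j := by
  unfold E
  refine sum_congr rfl fun x _ => ?_
  congr 1
  show ∏ i, A.K (σ i) (j (σ i)) (x (G.src (σ i))) (x (G.tgt (σ i))) = ∏ l, A.K l (j l) (x (G.src l)) (x (G.tgt l))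
  exact Equiv.prod_comp σ (fun l => A.K l (j l) (x (G.src l)) (x (G.tgt l)))

/-! ## (2.6): the total amplitude is the sum over all scale assignments -/

/-- The coupling/decay/norm factor of (1.33)/(2.13): `e^{d_v(G)} λ^{d_s(G)} exp[−½δ₁ d({□(v)})] (Π_v N^Φ_v)(Π_v N^A_v)`.
[cite: Balaban1983Higgs3, (1.33) p.420] -/
noncomputable def pref : ℝ :=
  A.eRun ^ (∑ v, A.dv v) * A.lamRun ^ (∑ v, A.ds v) * Real.exp (-(G.δ₁ / 2 * boxTreeLen G.L A.k A.box))
    * (∏ v, A.NPhi v) * ∏ v, A.NA v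

/-- `pref ≥ 0`. [cite: Balaban1983Higgs3, (1.33) p.420] -/
theorem pref_nonneg : 0 ≤ A.pref := by
  unfold pref
  have := A.eRun_nonneg
  have := A.lamRun_nonneg
  have h1 : 0 ≤ ∏ v, A.NPhi v := prod_nonneg fun v _ => A.NPhi_nonneg v
  have h2 : 0 ≤ ∏ v, A.NA v := prod_nonneg fun v _ => A.NA_nonneg v
  positivity

/-- **The total localized amplitude `E(G′, {□(v)}, Φ′_ext, A_ext)`** of p. 424: every line carries its FULL propagator,
decomposed by (2.6) into the scale pieces, `G_k = Σ_{t=0}^{k−1} G_(t)` ↦ `Σ_{t=0}^{k−1} K_l(t; ·, ·)`.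
[cite: Balaban1983Higgs3, (2.6) p.424] -/
noncomputable def Etot : ℝ :=
  ∑ x ∈ boxPositions G.toModel.L A.k A.box,
    (∏ v, A.η ^ G.toModel.d * A.u v (x v)) * ∏ l, ∑ t : Fin A.k, A.K l (t : ℕ) (x (G.toModel.src l)) (x (G.toModel.tgt l))

/-- p. 424: *"Thus we get a sum of new expressions obtained by replacing in each line l of the graph G′ the corresponding
propagator by a propagator G^η_{(j_l)}, 0 ≦ j_l ≦ k−1. … We can write E(G′) as a sum Σ_j E(G′(j))."* — PROVED for the model
(multilinearity in the line kernels). [cite: Balaban1983Higgs3, (2.6) p.424] -/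
theorem Etot_eq_sum_E : A.Etot = ∑ j : Fin m → Fin A.k, A.E (fun l => (j l : ℕ)) := by
  unfold Etot E
  have h : ∀ x : V → Fin G.toModel.d → ℕ,
      (∏ l, ∑ t : Fin A.k, A.K l (t : ℕ) (x (G.toModel.src l)) (x (G.toModel.tgt l)))
        = ∑ j : Fin m → Fin A.k, ∏ l, A.K l ((j l : Fin A.k) : ℕ) (x (G.toModel.src l)) (x (G.toModel.tgt l)) := by
    intro x
    rw [Finset.prod_univ_sum (fun _ : Fin m => (Finset.univ : Finset (Fin A.k)))
      (fun l t => A.K l (t : ℕ) (x (G.toModel.src l)) (x (G.toModel.tgt l))), Fintype.piFinset_univ]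
  simp_rw [h, Finset.mul_sum]
  exact Finset.sum_comm

/-! ## (1.33) for the sum with fixed ordering l̃, for any admissible J(l̃) -/

/-- **(1.33) for the sum with fixed ordering l̃** (p. 425: *"To prove the theorem it is sufficient to prove the estimate (1.33)
for the sum with fixed ordering l̃ on the right side above"*): for every admissible assignment l̃ ↦ J(l̃) of (2.7) and every
ordering σ such that the connected components of the subgraphs `G_1 ⊂ G_2 ⊂ … ⊂ G_m` built along σ (p. 425) have positive
degrees (p. 426), `|Σ_{j∈J(l̃)} E(G(j), {□(v)}, Φ′_ext, A_ext)| ≤ (Π_l C_l) · const215(G along σ) · e^{d_v(G)} λ^{d_s(G)}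
exp[−½δ₁ d({□(v)})] (Π N^Φ_v)(Π N^A_v)` — (2.13) (`Amp.abs_E_le`) termwise and (2.15) (`Model.ineq215_of_pos`) for the graph
relabeled along σ. [cite: Balaban1983Higgs3, Prop. 2.1 p.425] -/
theorem bound133_ordering (𝒜 : B3.Assignment m A.k) (σ : Equiv.Perm (Fin m))
    (hpos : ∀ i, i ≤ m → ∀ b ∈ (relabelCounts G σ).toModel.reps i, (relabelCounts G σ).toModel.Nontriv i b →
      0 < (relabelCounts G σ).toModel.D i b) :
    |∑ j ∈ 𝒜.J σ, A.E (fun l => ((j l : Fin A.k) : ℕ))|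
      ≤ (∏ l, A.C l) * (relabelCounts G σ).toModel.const215 * A.pref := by
  classical
  -- the reading of j ∈ J(l̃) along σ is a member of J(l̃) = Mon m k of the relabeled graph, injectively
  have hmem : ∀ j ∈ 𝒜.J σ, (fun i => ((j (σ i) : Fin A.k) : ℕ)) ∈ Model.Mon m A.k :=
    fun j hj => Model.mem_Mon_of_orderedAlong (𝒜.ordered σ j hj)
  have hinj : Set.InjOn (fun (j : Fin m → Fin A.k) (i : Fin m) => ((j (σ i) : Fin A.k) : ℕ)) ↑(𝒜.J σ) := by
    intro j _ j' _ h
    funext l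
    have e := congrFun h (σ.symm l)
    simp only [Equiv.apply_symm_apply] at e
    exact Fin.ext e
  -- (2.13) termwise for the relabeled amplitude, with the constants expressed through `A`
  have h213 : ∀ j' ∈ Model.Mon m A.k,
      |(A.relabel σ).E j'| ≤ (∏ l, A.C l) * A.pref * (relabelCounts G σ).toModel.W 0 A.k j' A.box := by
    intro j' hj'
    calc |(A.relabel σ).E j'| ≤ _ := (A.relabel σ).abs_E_le hj'
      _ = (∏ l, A.C l) * A.pref * (relabelCounts G σ).toModel.W 0 A.k j' A.box := by
          rw [A.prod_C_relabel σ]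
          rfl
  have hCP : 0 ≤ (∏ l, A.C l) * A.pref := mul_nonneg (prod_nonneg fun l _ => A.C_nonneg l) A.pref_nonneg
  calc |∑ j ∈ 𝒜.J σ, A.E (fun l => ((j l : Fin A.k) : ℕ))|
      ≤ ∑ j ∈ 𝒜.J σ, |A.E (fun l => ((j l : Fin A.k) : ℕ))| := abs_sum_le_sum_abs _ _
    _ = ∑ j ∈ 𝒜.J σ, |(A.relabel σ).E (fun i => ((j (σ i) : Fin A.k) : ℕ))| := by
        refine sum_congr rfl fun j _ => ?_
        rw [← A.E_relabel σ (fun l => ((j l : Fin A.k) : ℕ))]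
        rfl
    _ = ∑ j' ∈ (𝒜.J σ).image (fun (j : Fin m → Fin A.k) (i : Fin m) => ((j (σ i) : Fin A.k) : ℕ)),
          |(A.relabel σ).E j'| := by
        rw [sum_image hinj]
    _ ≤ ∑ j' ∈ Model.Mon m A.k, |(A.relabel σ).E j'| := by
        apply sum_le_sum_of_subset_of_nonneg
        · intro j' hj'
          obtain ⟨j, hj, rfl⟩ := mem_image.1 hj'
          exact hmem j hj
        · intro j' _ _
          exact abs_nonneg _
    _ ≤ ∑ j' ∈ Model.Mon m A.k, (∏ l, A.C l) * A.pref * (relabelCounts G σ).toModel.W 0 A.k j' A.box :=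
        sum_le_sum h213
    _ = (∏ l, A.C l) * A.pref * ∑ j' ∈ Model.Mon m A.k, (relabelCounts G σ).toModel.W 0 A.k j' A.box := by
        rw [mul_sum]
    _ ≤ (∏ l, A.C l) * A.pref * (relabelCounts G σ).toModel.const215 :=
        mul_le_mul_of_nonneg_left ((relabelCounts G σ).toModel.ineq215_of_pos hpos A.k A.box) hCP
    _ = (∏ l, A.C l) * (relabelCounts G σ).toModel.const215 * A.pref := by ring

/-! ## (1.33) for the total amplitude: the sum over the orderings -/

/-- **The bound (1.33) of Proposition 2.1 for the total localized amplitude of the model** (pp. 424–428 assembled: (2.6),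
(2.7) with ANY admissible J(l̃) — here `B3.Assignment.bySort` —, (2.13) and (2.15) ordering by ordering, then the sum over the
`m!` orderings): if for every ordering l̃ the connected components of the subgraphs `G_1 ⊂ … ⊂ G_m` have positive degrees,
then `|E(G′, {□(v)}, Φ′_ext, A_ext)| ≤ (Π_l C_l) · (Σ_{l̃} const215(G along l̃)) · e^{d_v(G)} λ^{d_s(G)} exp[−½δ₁ d({□(v)})]
(Π N^Φ_v)(Π N^A_v)`, uniformly in `k` and in the unit cubes `□(v)`. [cite: Balaban1983Higgs3, Prop. 2.1 p.424] -/
theorem bound133_total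
    (hpos : ∀ σ : Equiv.Perm (Fin m), ∀ i, i ≤ m → ∀ b ∈ (relabelCounts G σ).toModel.reps i,
      (relabelCounts G σ).toModel.Nontriv i b → 0 < (relabelCounts G σ).toModel.D i b) :
    |A.Etot| ≤ (∏ l, A.C l) * (∑ σ : Equiv.Perm (Fin m), (relabelCounts G σ).toModel.const215) * A.pref := by
  rw [A.Etot_eq_sum_E, B3.display27 (B3.Assignment.bySort m A.k)]
  calc |∑ σ : Equiv.Perm (Fin m), ∑ j ∈ (B3.Assignment.bySort m A.k).J σ, A.E (fun l => ((j l : Fin A.k) : ℕ))|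
      ≤ ∑ σ : Equiv.Perm (Fin m), |∑ j ∈ (B3.Assignment.bySort m A.k).J σ, A.E (fun l => ((j l : Fin A.k) : ℕ))| :=
        abs_sum_le_sum_abs _ _
    _ ≤ ∑ σ : Equiv.Perm (Fin m), (∏ l, A.C l) * (relabelCounts G σ).toModel.const215 * A.pref :=
        sum_le_sum fun σ _ => A.bound133_ordering (B3.Assignment.bySort m A.k) σ (hpos σ)
    _ = (∏ l, A.C l) * (∑ σ : Equiv.Perm (Fin m), (relabelCounts G σ).toModel.const215) * A.pref := by
        rw [mul_sum, sum_mul]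

end Amp

end Literature.MathematicalPhysics.QuantumFieldTheory.Balaban1983to89.B3Ineq213
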